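import Literature.Probability.Percolation.QuadCrossingSquareModel
import Literature.Probability.RandomPlanarGeometry.ModulusSymmetry
import Literature.Probability.RandomPlanarGeometry.ConformalRectangleShift
import HarnessLib

/-!
# Cardy cross-ratio of the model rectangle `rectQuad` (line `Sketch`, stub `stub_boxCrossRatio`)

Crux `Summit.CriticalPhenomena.CardyFormulaZ2.Theses.CardySelfDualSegment.SegmentClosed`
(stmt-CriticalPhenomena-5473), line `Sketch`, stub `stub_boxCrossRatio`.

The model rectangle `R = rectQuad 0 w 0 h` of the tree (`QuadCrossingSquareModel.lean`) is the box
`(0,w) × (0,h)` with its corners marked counterclockwise from the bottom-left one,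
`(P₀, P₁, P₂, P₃) = (0, w, w + ih, ih)` (`rectQuad_pt`, read off the side descriptions
`mem_rectQuad_arc_*`).  The Bollobás–Riordan marking `(ih, 0, w, w + ih)` of the same box, whose
Cardy cross-ratio is `η(w/h)` for every uniformizing datum (hypothesis `hη`, the `∀`-clause of the
tree fact `rectangle_crossRatio_eq_of_aspectRatio`), is the cyclic re-marking
`F = (Ω; P₃, P₀, P₁, P₂)` of `R`, which exists as a `ConformalRectangle` with the same carrier
(`exists_pt_eq_add_three`: three applications of the tree's `MarkedDomain.exists_shiftMarks`).
A uniformizing map `φ` of `R` with boundary tuple `x` has the boundary values `F.pt i` at the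
cyclically rotated tuple `y = (x₃, x₀, x₁, x₂)`, increasing only up to the position of `∞`; the
real Möbius map `z ↦ c - 1/z` of `ℍₒ` renormalises it to a genuine uniformizing datum of `F`
(`ConformalRectangle.exists_isUniformizing_of_cyclic`) with the same cross-ratio
`crossRatio y = 1 - crossRatio x` (the tree's `crossRatio_perm_0321` with `crossRatio_rev`); by
`hη` it is `η(w/h)`, whence `crossRatio x = 1 - η(w/h)` (`stub_boxCrossRatio`).  No conformal
invariance of the cross-ratio and no existence theorem for uniformizing maps is used.

References: L. V. Ahlfors, *Complex Analysis*, 3rd ed. (1979), Ch. 3 §3.1 (cross-ratio) and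
Ch. 6 §1.1; V. Beffara, *Is critical 2D percolation universal?*, Progr. Probab. 60 (2008), proof
of Prop. 4 (conjugate marking has modulus `1 - η`); B. Bollobás, O. Riordan, *Percolation*
(2006), Ch. 7 §7.1 (the marking `(ih, 0, w, w + ih)`).
-/

noncomputable section

open Set Filter Metric Complex
open scoped Topology
open UpperHalfPlane (upperHalfPlaneSet)
open Literature.Probability.RandomPlanarGeometry Literature.Probability.Percolation

namespace Summit.CriticalPhenomena.CardyFormulaZ2.Cruxes.SegmentClosed.Sketch

namespace BoxCrossRatio

/-! ### Cyclic re-markings of a conformal rectangle -/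

/-- **Re-marking by one.** Every conformal rectangle `R = (Ω; P₀, P₁, P₂, P₃)` has a cyclically
re-marked copy `R' = (Ω; P₁, P₂, P₃, P₀)` with the same carrier: `R'.pt i = R.pt (i + 1)`
(the tree's `MarkedDomain.exists_shiftMarks`, reading off the marked points from the shifted
boundary loop `u ↦ R.boundary (u + m₁)` and the marks `(0, m₂ - m₁, m₃ - m₁, m₀ + 1 - m₁)`).
[folklore] -/
theorem exists_pt_eq_add_one (R : ConformalRectangle) :
    ∃ R' : ConformalRectangle, R'.carrier = R.carrier ∧ ∀ i, R'.pt i = R.pt (i + 1) := by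
  obtain ⟨R', hc, hb, hm, -, -, -, -⟩ := R.exists_shiftMarks
  refine ⟨R', hc, ?_⟩
  have h0 : R'.pt 0 = R.pt 1 := by
    show R'.boundary (R'.mark 0) = R.boundary (R.mark 1)
    rw [hb, hm]
    show R.boundary (0 + R.mark 1) = R.boundary (R.mark 1)
    rw [zero_add]
  have h1 : R'.pt 1 = R.pt 2 := by
    show R'.boundary (R'.mark 1) = R.boundary (R.mark 2)
    rw [hb, hm]
    show R.boundary (R.mark 2 - R.mark 1 + R.mark 1) = R.boundary (R.mark 2)
    rw [sub_add_cancel]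
  have h2 : R'.pt 2 = R.pt 3 := by
    show R'.boundary (R'.mark 2) = R.boundary (R.mark 3)
    rw [hb, hm]
    show R.boundary (R.mark 3 - R.mark 1 + R.mark 1) = R.boundary (R.mark 3)
    rw [sub_add_cancel]
  have h3 : R'.pt 3 = R.pt 0 := by
    show R'.boundary (R'.mark 3) = R.boundary (R.mark 0)
    rw [hb, hm]
    show R.boundary (R.mark 0 + 1 - R.mark 1 + R.mark 1) = R.boundary (R.mark 0)
    rw [sub_add_cancel]
    exact R.periodic_boundary _
  intro i
  fin_cases i
  · exact h0
  · exact h1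
  · exact h2
  · exact h3

/-- **Re-marking by three.** Every conformal rectangle `R = (Ω; P₀, P₁, P₂, P₃)` has a cyclically
re-marked copy `R' = (Ω; P₃, P₀, P₁, P₂)` with the same carrier: `R'.pt i = R.pt (i + 3)`
(three re-markings by one). [folklore] -/
theorem exists_pt_eq_add_three (R : ConformalRectangle) :
    ∃ R' : ConformalRectangle, R'.carrier = R.carrier ∧ ∀ i, R'.pt i = R.pt (i + 3) := by
  obtain ⟨R₁, hc₁, hp₁⟩ := exists_pt_eq_add_one R
  obtain ⟨R₂, hc₂, hp₂⟩ := exists_pt_eq_add_one R₁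
  obtain ⟨R₃, hc₃, hp₃⟩ := exists_pt_eq_add_one R₂
  refine ⟨R₃, hc₃.trans (hc₂.trans hc₁), fun i => ?_⟩
  have e : i + 1 + 1 + 1 = i + 3 := by
    rw [add_assoc, add_assoc]
    rfl
  rw [hp₃, hp₂, hp₁, e]

/-! ### Möbius bookkeeping for the re-marking by three -/

/-- **The re-marking by three is uniformized with cross-ratio `1 - η`.** Let `F` be a conformal
rectangle with carrier `S` and marked points `F.pt i = p (i + 3)`, and let `φ : ℍₒ → S` be a
conformal equivalence with boundary values `p i` at a strictly monotone (or antitone) real tuple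
`x` (a uniformizing datum of the marking `p`). Then `F` has a uniformizing datum of cross-ratio
`1 - crossRatio x`: `φ` has the boundary values `F.pt i` at the cyclically rotated tuple
`y i = x (i + 3)`, i.e. `(x₃, x₀, x₁, x₂)`, increasing in the pattern `y₁ < y₂ < y₃ < y₀` (or its
reverse), which the real Möbius map `z ↦ c - 1/z` of `ℍₒ` renormalises to a genuine uniformizing
datum (`ConformalRectangle.exists_isUniformizing_of_cyclic`) with the same cross-ratio
`crossRatio y = 1 - crossRatio x` (`crossRatio_perm_0321` applied to the reversed tuple, and
`crossRatio_rev`). Ahlfors (1979), Ch. 3 §3.1 and Ch. 6 §1.1; Beffara (2008), proof of Prop. 4.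
[folklore] -/
theorem exists_isUniformizing_of_pt_eq_add_three (F : ConformalRectangle) {S : Set ℂ}
    (hc : F.carrier = S) (p : Fin 4 → ℂ) (hp : ∀ i, F.pt i = p (i + 3))
    (φ : ConformalEquiv upperHalfPlaneSet S) {x : Fin 4 → ℝ} (hmono : StrictMono x ∨ StrictAnti x)
    (hbv : ∀ i, φ.HasBoundaryValue (x i) (p i)) :
    ∃ (φ' : ConformalEquiv upperHalfPlaneSet F.carrier) (x' : Fin 4 → ℝ),
      F.IsUniformizing φ' x' ∧ crossRatio x' = 1 - crossRatio x := by
  subst hc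
  -- boundary values of `φ` for the marking of `F`, at the rotated tuple `y`
  set y : Fin 4 → ℝ := fun i => x (i + 3) with hy
  have hbv' : ∀ i, φ.HasBoundaryValue (y i) (F.pt i) := by
    intro i
    rw [hp i]
    exact hbv (i + 3)
  -- `y` is increasing only cyclically
  have hpat : (y 1 < y 2 ∧ y 2 < y 3 ∧ y 3 < y 0) ∨ (y 0 < y 3 ∧ y 3 < y 2 ∧ y 2 < y 1) := by
    have e0 : y 0 = x 3 := rfl
    have e1 : y 1 = x 0 := rfl
    have e2 : y 2 = x 1 := rfl
    have e3 : y 3 = x 2 := rfl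
    rw [e0, e1, e2, e3]
    rcases hmono with hm | hm
    · exact Or.inl ⟨hm (by decide), hm (by decide), hm (by decide)⟩
    · exact Or.inr ⟨hm (by decide), hm (by decide), hm (by decide)⟩
  -- Möbius renormalisation, same cross-ratio
  obtain ⟨φ', x', hφ', hcr⟩ := ConformalRectangle.exists_isUniformizing_of_cyclic F φ y hbv' hpat
  -- the cyclic identity `η(x₃, x₀, x₁, x₂) = 1 - η(x)`: `y` is the pair-swapped tuple
  -- `(x'₀, x'₃, x'₂, x'₁)` of the reversal `x' = x ∘ rev`
  -- (`crossRatio_perm_0321`, `crossRatio_rev`)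
  have hinj : Function.Injective x := hmono.elim StrictMono.injective StrictAnti.injective
  have key : crossRatio y = 1 - crossRatio x := by
    have e : y = ![(x ∘ Fin.rev) 0, (x ∘ Fin.rev) 3, (x ∘ Fin.rev) 2, (x ∘ Fin.rev) 1] := by
      funext i
      fin_cases i <;> rfl
    have h02 : Fin.rev (0 : Fin 4) ≠ Fin.rev 2 := by decide
    have h13 : Fin.rev (1 : Fin 4) ≠ Fin.rev 3 := by decide
    rw [e, crossRatio_perm_0321 (x ∘ Fin.rev) (hinj.ne h02) (hinj.ne h13), crossRatio_rev]
  exact ⟨φ', x', hφ', hcr.trans key⟩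

/-! ### The corners of the model rectangle -/

/-- The marked points of `rectQuad x₀ x₁ y₀ y₁` are its corners `(x₀,y₀), (x₁,y₀), (x₁,y₁), (x₀,y₁)`
(counterclockwise from the bottom-left one), read off the side descriptions `mem_rectQuad_arc_*`
of the tree: `pt k ∈ arc k ∩ arc (k-1)`. [folklore] -/
theorem rectQuad_pt {x₀ x₁ y₀ y₁ : ℝ} (hx : x₀ < x₁) (hy : y₀ < y₁) :
    (rectQuad x₀ x₁ y₀ y₁ hx hy).pt 0 = ⟨x₀, y₀⟩ ∧ (rectQuad x₀ x₁ y₀ y₁ hx hy).pt 1 = ⟨x₁, y₀⟩ ∧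
      (rectQuad x₀ x₁ y₀ y₁ hx hy).pt 2 = ⟨x₁, y₁⟩ ∧
        (rectQuad x₀ x₁ y₀ y₁ hx hy).pt 3 = ⟨x₀, y₁⟩ := by
  -- adapted from `RectilinearCardy.Negative.rectQuad_pt` (RectilinearCardyReductions.lean)
  set Q := rectQuad x₀ x₁ y₀ y₁ hx hy
  have a0 : Q.pt 0 ∈ Q.arc 0 := Q.pt_mem_arc_self 0
  have a1 : Q.pt 1 ∈ Q.arc 1 := Q.pt_mem_arc_self 1
  have a2 : Q.pt 2 ∈ Q.arc 2 := Q.pt_mem_arc_self 2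
  have a3 : Q.pt 3 ∈ Q.arc 3 := Q.pt_mem_arc_self 3
  have b3 : Q.pt 0 ∈ Q.arc 3 := by simpa using Q.pt_succ_mem_arc 3
  have b0 : Q.pt 1 ∈ Q.arc 0 := by simpa using Q.pt_succ_mem_arc 0
  have b1 : Q.pt 2 ∈ Q.arc 1 := by simpa using Q.pt_succ_mem_arc 1
  have b2 : Q.pt 3 ∈ Q.arc 2 := by simpa using Q.pt_succ_mem_arc 2
  rw [mem_rectQuad_arc_zero] at a0 b0
  rw [mem_rectQuad_arc_one] at a1 b1
  rw [mem_rectQuad_arc_two] at a2 b2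
  rw [mem_rectQuad_arc_three] at a3 b3
  refine ⟨?_, ?_, ?_, ?_⟩ <;> apply Complex.ext <;>
    simp [a0.1, b3.1, a1.1, b0.1, a2.1, b1.1, a3.1, b2.1]

end BoxCrossRatio

open BoxCrossRatio

/-- **Cardy cross-ratio of the model rectangle `rectQuad`.** `rectQuad 0 w 0 h` is the box
`(0,w) × (0,h)` with corners marked counterclockwise from the bottom-left one (arc `0` = bottom,
arc `2` = top); it is the cyclic shift by one of the marking `(ih, 0, w, w + ih)` (arc `0` = left
side) whose cross-ratio is `η(w/h)` (`rectangle_crossRatio_eq_of_aspectRatio`, hypothesis `hη`),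
so its cross-ratio is `1 - η(w/h)`: the re-marking `F = ((0,w)×(0,h); ih, 0, w, w + ih)` of
`rectQuad 0 w 0 h` exists with the same carrier (`exists_pt_eq_add_three`, `rectQuad_pt`), a
uniformizing datum `(φ, x)` of `rectQuad 0 w 0 h` yields one of `F` with cross-ratio
`1 - crossRatio x` (Möbius renormalisation of the rotated boundary tuple,
`exists_isUniformizing_of_pt_eq_add_three`), and `hη` evaluates the latter as `η(w/h)`.
Ahlfors (1979), Ch. 3 §3.1; Beffara (2008), proof of Prop. 4; Bollobás–Riordan (2006), Ch. 7 §7.1.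
[folklore] -/
theorem stub_boxCrossRatio (η : ℝ → ℝ)
    (hη : ∀ (R : ConformalRectangle) (w h : ℝ), 0 < w → 0 < h →
      R.carrier = (Ioo (0:ℝ) w ×ℂ Ioo (0:ℝ) h) →
      (R.pt 0 = (h:ℂ) * I ∧ R.pt 1 = 0 ∧ R.pt 2 = (w:ℂ) ∧ R.pt 3 = (w:ℂ) + (h:ℂ) * I) →
      ∀ (φ : ConformalEquiv upperHalfPlaneSet R.carrier) (x : Fin 4 → ℝ), R.IsUniformizing φ x →
        crossRatio x = η (w / h))
    {w h : ℝ} (hw : 0 < w) (hh : 0 < h)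
    (φ : ConformalEquiv upperHalfPlaneSet (rectQuad 0 w 0 h hw hh).carrier) (x : Fin 4 → ℝ)
    (hx : (rectQuad 0 w 0 h hw hh).IsUniformizing φ x) :
    crossRatio x = 1 - η (w / h) := by
  -- the re-marked box `F = ((0,w)×(0,h); ih, 0, w, w + ih)`, same carrier as `rectQuad 0 w 0 h`
  obtain ⟨F, hcF, hpF⟩ := exists_pt_eq_add_three (rectQuad 0 w 0 h hw hh)
  -- a uniformizing datum of `F` of cross-ratio `1 - crossRatio x`
  obtain ⟨φ', x', hφ', hcr⟩ :=
    exists_isUniformizing_of_pt_eq_add_three F hcF _ hpF φ hx.1 hx.2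
  -- the carrier and the marked points of `F`
  have hc' : F.carrier = (Ioo (0:ℝ) w ×ℂ Ioo (0:ℝ) h) := hcF.trans (rectQuad_carrier hw hh)
  obtain ⟨p0, p1, p2, p3⟩ := rectQuad_pt hw hh (x₀ := 0) (y₀ := 0)
  have q0 : F.pt 0 = (h:ℂ) * I := by
    rw [hpF]
    change (rectQuad 0 w 0 h hw hh).pt 3 = _
    rw [p3]
    apply Complex.ext <;> simp
  have q1 : F.pt 1 = 0 := by
    rw [hpF]
    change (rectQuad 0 w 0 h hw hh).pt 0 = _
    rw [p0]
    apply Complex.ext <;> simp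
  have q2 : F.pt 2 = (w:ℂ) := by
    rw [hpF]
    change (rectQuad 0 w 0 h hw hh).pt 1 = _
    rw [p1]
    apply Complex.ext <;> simp
  have q3 : F.pt 3 = (w:ℂ) + (h:ℂ) * I := by
    rw [hpF]
    change (rectQuad 0 w 0 h hw hh).pt 2 = _
    rw [p2]
    apply Complex.ext <;> simp
  -- `hη` evaluates the cross-ratio of the datum of `F`
  have key : crossRatio x' = η (w / h) := hη F w h hw hh hc' ⟨q0, q1, q2, q3⟩ φ' x' hφ'
  linarith

end Summit.CriticalPhenomena.CardyFormulaZ2.Cruxes.SegmentClosed.Sketch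

end
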